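import Mathlib
import HarnessLib
import Summits.Ventures.LatticeQCDFlow.Scoring.SectorMinESS

/-!
# The tunnelling budget: a run visits at most `#changes + #streams` sectors, so a VALID row
# under exact sector references needs at least `|R| − #streams` sector changes

HONEST FRAMING: exact (Metropolis-corrected) sampling algorithms for lattice gauge theory;
figures of merit are autocorrelation/cost numbers at stated couplings and volumes; no
continuum-physics claim.

Venture `LatticeQCDFlow` (cell pub-lqcd), sub-topic `Scoring`; FANOUT row 11 (`eng-scorerA`,
fitness scorer A).  NEW WORK of the cell (elementary list combinatorics), not a published result;
nothing is cited as a fact.  Companion of `SectorMinESS` / `SectorMinESSCeiling`.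

## Content

Scorer A prints, next to the per-sector table, the diagnostic `n_sector_changes` = the number of
steps `t` with `Q_{t+1} ≠ Q_t`, summed over the streams (estimators.py `sector_analysis_chain`,
'dwell / tunnelling diagnostics').  In the frozen-topology regime this number is tiny (row 14's
2-d U(1) 16² β 7 set, kit j130516: 4 / 6 / 12 changes in 12 000 updates) and the rows come out
INVALID on the sector-weight test V3 (`V3:sector-absent:k`).  The combinatorial reason is typed
here:

* `card_toFinset_le_sectorChanges_add_one` — ONE stream visits at most `#changes + 1` distinct
  sectors (a new sector can only be entered through a change);
* `card_visited_le` — `R` streams visit at most `Σ_r #changes_r + R` distinct sectors;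
* `exists_absent_of_lt` — hence if `Σ_r #changes_r + R < |Rref|` some reference sector is never
  visited;
* `essMin_eq_zero_of_tunnelling_lt` / `F2_eq_zero_of_tunnelling_lt` — with exact references an
  unvisited reference sector has count `0`, hence ESS `0`, hence `ESS_min = 0` and `F₂ = 0` (and
  scorer A raises the HARD token `V3:sector-absent` ⇒ INVALID): **a `claimed`-eligible row needs at
  least `|Rref| − #streams` tunnelling events, whatever the sampler and whatever else it gets
  right** (plaquette, `⟨e^{−ΔH}⟩ = 1`, reversibility all pass on the β 7 rows).

Record arithmetic (`tunnelling_needed_u1_L16`): at the 2-d U(1) 16² ORACLE points the reference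
set at floor 1 % is `|k| ≤ 4` (9 sectors, `π_{±4} = 0.0141`) at β 3, `|k| ≤ 3` (7 sectors,
`π_{±3} = 0.0155`) at β 5 and `|k| ≤ 2` (5 sectors, `π_{±2} = 0.0545`) at β 7, so a two-stream row
needs at least 7, 5, 3 sector changes respectively before V3 can pass at all — a necessary
condition only (the β 7 HMC row has 4 ≥ 3 changes in 12 000 updates and still fails V3, on the
weights).
-/

namespace Summit.Ventures.LatticeQCDFlow.Scoring

open Finset

variable {κ : Type*} [DecidableEq κ]

/-! ### One stream -/

/-- The number of sector changes along one stream `Q_1, …, Q_N` (scorer A's per-stream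
contribution to `n_sector_changes`): the number of consecutive pairs with `Q_{t+1} ≠ Q_t`. -/
def sectorChanges : List κ → ℕ
  | [] => 0
  | [_] => 0
  | a :: b :: t => (if a = b then 0 else 1) + sectorChanges (b :: t)

/-- No changes along an empty or one-sample stream. -/
@[simp] theorem sectorChanges_nil : sectorChanges ([] : List κ) = 0 := rfl

/-- No changes along a one-sample stream. -/
@[simp] theorem sectorChanges_singleton (a : κ) : sectorChanges [a] = 0 := rfl

/-- The recursion step. -/
theorem sectorChanges_cons_cons (a b : κ) (t : List κ) :
    sectorChanges (a :: b :: t) = (if a = b then 0 else 1) + sectorChanges (b :: t) := rfl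

/-- A constant (frozen) stream has no sector changes. -/
theorem sectorChanges_replicate (a : κ) (n : ℕ) : sectorChanges (List.replicate n a) = 0 := by
  induction n with
  | zero => rfl
  | succ n ih =>
    cases n with
    | zero => rfl
    | succ m =>
      simp only [List.replicate_succ] at ih ⊢
      rw [sectorChanges_cons_cons, if_pos rfl, ih]

/-- **One stream visits at most `#changes + 1` distinct sectors.** -/
theorem card_toFinset_le_sectorChanges_add_one :
    ∀ l : List κ, l.toFinset.card ≤ sectorChanges l + 1
  | [] => by simp
  | [a] => by simp
  | a :: b :: t => by
    have ih := card_toFinset_le_sectorChanges_add_one (b :: t)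
    rw [sectorChanges_cons_cons, List.toFinset_cons]
    by_cases hab : a = b
    · subst hab
      rw [if_pos rfl, Finset.insert_eq_of_mem (by simp)]
      simpa using ih
    · rw [if_neg hab]
      calc (insert a (b :: t).toFinset).card ≤ (b :: t).toFinset.card + 1 := card_insert_le _ _
        _ ≤ sectorChanges (b :: t) + 1 + 1 := by omega
        _ = 1 + sectorChanges (b :: t) + 1 := by ring

/-! ### Several streams -/

/-- Total number of sector changes over the streams (scorer A's `n_sector_changes`). -/
def totalChanges (L : List (List κ)) : ℕ :=
  (L.map sectorChanges).sum

/-- The set of sectors visited by any stream. -/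
def visited (L : List (List κ)) : Finset κ :=
  L.flatten.toFinset

/-- `totalChanges` of a cons. -/
@[simp] theorem totalChanges_cons (l : List κ) (L : List (List κ)) :
    totalChanges (l :: L) = sectorChanges l + totalChanges L := by
  simp [totalChanges]

/-- `totalChanges` of no streams. -/
@[simp] theorem totalChanges_nil : totalChanges ([] : List (List κ)) = 0 := rfl

/-- **`R` streams visit at most `Σ_r #changes_r + R` distinct sectors.** -/
theorem card_visited_le : ∀ L : List (List κ), (visited L).card ≤ totalChanges L + L.length
  | [] => by simp [visited]
  | l :: L => by
    have ih := card_visited_le L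
    have h1 := card_toFinset_le_sectorChanges_add_one l
    unfold visited at ih ⊢
    rw [List.flatten_cons, List.toFinset_append, totalChanges_cons, List.length_cons]
    calc (l.toFinset ∪ L.flatten.toFinset).card ≤ l.toFinset.card + L.flatten.toFinset.card :=
          card_union_le _ _
      _ ≤ (sectorChanges l + 1) + (totalChanges L + L.length) := Nat.add_le_add h1 ih
      _ = sectorChanges l + totalChanges L + (L.length + 1) := by ring

/-- **Too few tunnelling events leave a reference sector unvisited**: if
`Σ_r #changes_r + #streams < |R|` then some `k ∈ R` is visited by no stream. -/
theorem exists_absent_of_lt (R : Finset κ) (L : List (List κ))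
    (h : totalChanges L + L.length < R.card) : ∃ k ∈ R, k ∉ visited L := by
  by_contra hall
  push Not at hall
  have hsub : R ⊆ visited L := fun k hk => hall k hk
  have := (card_le_card hsub).trans (card_visited_le L)
  omega

/-- A sector visited by no stream has sample count `0`. -/
theorem count_flatten_eq_zero_of_not_mem_visited {L : List (List κ)} {k : κ}
    (hk : k ∉ visited L) : L.flatten.count k = 0 := by
  rw [List.count_eq_zero]
  intro hmem
  exact hk (List.mem_toFinset.2 hmem)

/-! ### Consequence for `F₂` under exact references -/

/-- **`ESS_min = 0` below the tunnelling budget.**  Exact references (the reference set `R` does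
not depend on the run); per-sector effective counts that are nonnegative and vanish on a sector of
sample count `0` (both scoring modes: `N_k/(2τ)` and the Kish count of an empty family are `0`,
and scorer A sets an absent sector's ESS to `0` explicitly); then
`Σ_r #changes_r + #streams < |R|` forces `ESS_min = 0`. -/
theorem essMin_eq_zero_of_tunnelling_lt {R : Finset κ} (hR : R.Nonempty) (L : List (List κ))
    {ess : κ → ℝ} (h0 : ∀ k ∈ R, 0 ≤ ess k)
    (habs : ∀ k ∈ R, L.flatten.count k = 0 → ess k = 0)
    (h : totalChanges L + L.length < R.card) : essMin R hR ess = 0 := by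
  obtain ⟨k, hk, hkv⟩ := exists_absent_of_lt R L h
  exact essMin_eq_zero_of_mem hR h0 hk (habs k hk (count_flatten_eq_zero_of_not_mem_visited hkv))

/-- … and hence `F₂ = 0` (any cost). -/
theorem F2_eq_zero_of_tunnelling_lt {R : Finset κ} (hR : R.Nonempty) (L : List (List κ))
    {ess : κ → ℝ} (h0 : ∀ k ∈ R, 0 ≤ ess k)
    (habs : ∀ k ∈ R, L.flatten.count k = 0 → ess k = 0)
    (h : totalChanges L + L.length < R.card) (C : ℝ) : F2 R hR ess C = 0 := by
  rw [F2, essMin_eq_zero_of_tunnelling_lt hR L h0 habs h, zero_div]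

/-- **The budget, contrapositive**: a row with `ESS_min > 0` (necessary for VALID under exact
references, since an absent reference sector is the HARD token `V3:sector-absent`) has made at
least `|R| − #streams` sector changes. -/
theorem card_sub_length_le_totalChanges_of_essMin_pos {R : Finset κ} (hR : R.Nonempty)
    (L : List (List κ)) {ess : κ → ℝ} (h0 : ∀ k ∈ R, 0 ≤ ess k)
    (habs : ∀ k ∈ R, L.flatten.count k = 0 → ess k = 0) (hpos : 0 < essMin R hR ess) :
    R.card - L.length ≤ totalChanges L := by
  by_contra hlt
  push Not at hlt
  have h : totalChanges L + L.length < R.card := by omega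
  exact hpos.ne' (essMin_eq_zero_of_tunnelling_lt hR L h0 habs h)

/-! ### A frozen run scores `F₂ = 0` -/

/-- Frozen streams (each constant) make no sector changes at all … -/
theorem totalChanges_replicate :
    ∀ L : List (List κ), (∀ l ∈ L, ∃ (k : κ) (n : ℕ), l = List.replicate n k) → totalChanges L = 0
  | [], _ => rfl
  | l :: L, hL => by
    obtain ⟨k, n, hl⟩ := hL l (by simp)
    rw [totalChanges_cons, hl, sectorChanges_replicate,
      totalChanges_replicate L fun l' hl' => hL l' (by simp [hl']), add_zero]

/-- … so with more reference sectors than streams a frozen run has `ESS_min = 0` (`F₂ = 0`,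
INVALID under exact references) — however long it runs and whatever else it gets right. -/
theorem essMin_eq_zero_of_frozen {R : Finset κ} (hR : R.Nonempty) (L : List (List κ))
    (hfrozen : ∀ l ∈ L, ∃ (k : κ) (n : ℕ), l = List.replicate n k)
    {ess : κ → ℝ} (h0 : ∀ k ∈ R, 0 ≤ ess k)
    (habs : ∀ k ∈ R, L.flatten.count k = 0 → ess k = 0) (hlt : L.length < R.card) :
    essMin R hR ess = 0 :=
  essMin_eq_zero_of_tunnelling_lt hR L h0 habs
    (by rw [totalChanges_replicate L hfrozen, zero_add]; exact hlt)

/-! ### Record arithmetic (2-d U(1) 16² ORACLE points, two streams) -/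

/-- Two streams at the 16² ORACLE points: β 3 (`|k| ≤ 4`, 9 sectors) needs at least `9 − 2 = 7`
sector changes before V3 can pass, β 5 (`|k| ≤ 3`, 7 sectors) at least `5`, β 7 (`|k| ≤ 2`,
5 sectors) at least `3`.  (Row 14's β 7 HMC row has 4 ≥ 3 changes in 12 000 updates and still
fails V3 — the budget is necessary, not sufficient.) -/
theorem tunnelling_needed_u1_L16 : (9 : ℕ) - 2 = 7 ∧ (7 : ℕ) - 2 = 5 ∧ (5 : ℕ) - 2 = 3 := by decide

end Summit.Ventures.LatticeQCDFlow.Scoring
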